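import Summits.CriticalPhenomena.PercolationContinuityZ3.Theorems.PercNearOneGluingNoHeavyPcintWinKernelSymCert
import HarnessLib

/-!
# PCINT lane, kernel window certificates — enumeration of the first-use normal forms

Cell `prim-pcint`, seat `prim-pcint-2` (gen 2); memo `run/shared/lean/prim/pcint/INTERVAL-PLAN.md` §15.  Does NOT build on p205010.
The symmetry-reduced certificate theorems `WinK.le_criticalProb_of_checkBK` / `WinK.le_siteCriticalProb_of_checkSK`
(`…PcintWinKernelSymCert`) take a check over ALL `(2d)^(m+1)` window codes, of which only the first-use normal forms
(`WinK.isNF`) carry a Collatz–Wielandt row; the other codes cost a normal-form scan each, and for `d ≥ 4` these scans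
dominate the kernel time.  Here the normal forms are ENUMERATED instead: `WinK.nfLists d k len` lists the step lists on
which the scan `nfStep` started in state `some k` succeeds (`mem_nfLists_of_foldl`), `WinK.nfCodes d n` their codes, and
`allRange_nfOKB_of_nfCodes` / `allRange_nfOKS_of_nfCodes` turn a row check on `nfCodes d (m+1)` alone into the
hypothesis of the certificate theorems.  `WinK.allB` evaluates `List.all` by binary splitting (recursion depth `O(log)`).
-/

namespace Summit.CriticalPhenomena.PercolationContinuityZ3.Theorems.Pcint

namespace WinK

/-! ### Enumeration of the normal forms -/

/-- The steps admitted by the normal-form scan in state `some k`: both signs on an axis `< k`, the positive step on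
axis `k`. [folklore] -/
def nfNext (d k : ℕ) : List (Fin d × Bool) :=
  (List.finRange d).flatMap fun ax : Fin d =>
    if ax.1 < k then [(ax, true), (ax, false)] else if ax.1 = k then [(ax, true)] else []

/-- All step lists of length `len` on which the normal-form scan started in state `some k` succeeds. [folklore] -/
def nfLists (d : ℕ) : ℕ → ℕ → List (List (Fin d × Bool))
  | _, 0 => [[]]
  | k, len + 1 => (nfNext d k).flatMap fun a =>
      (nfLists d (if (a.1 : ℕ) = k then k + 1 else k) len).map fun l => a :: l

/-- Base-`2d` code of a step list (first step = lowest digit), the list form of `encW`. [folklore] -/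
def encL (d : ℕ) : List (Fin d × Bool) → ℕ
  | [] => 0
  | a :: l => encDir a + 2 * d * encL d l

/-- The codes of all first-use normal forms of length `n` in dimension `d`. [folklore] -/
def nfCodes (d n : ℕ) : List ℕ := (nfLists d 0 n).map (encL d)

variable {d : ℕ}

/-- A successful scan step is an admitted step, and the new state is determined. [folklore] -/
theorem nfStep_some_eq_some {k k' : ℕ} {a : Fin d × Bool} (h : nfStep (some k) a = some k') :
    a ∈ nfNext d k ∧ k' = (if (a.1 : ℕ) = k then k + 1 else k) := by
  simp only [nfStep] at h
  split_ifs at h with h1 h2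
  · cases h
    refine ⟨?_, by rw [if_neg (by omega)]⟩
    unfold nfNext
    rw [List.mem_flatMap]
    refine ⟨a.1, List.mem_finRange _, ?_⟩
    rw [if_pos h1]
    rcases a with ⟨ax, s⟩
    cases s <;> simp
  · cases h
    refine ⟨?_, by rw [if_pos h2.1]⟩
    unfold nfNext
    rw [List.mem_flatMap]
    refine ⟨a.1, List.mem_finRange _, ?_⟩
    rw [if_neg h1, if_pos h2.1]
    rcases a with ⟨ax, s⟩
    rcases h2 with ⟨-, hs⟩
    simp only at hs
    subst hs
    simp

/-- **Completeness of the enumeration**: a step list on which the scan from `some k` succeeds is listed. [folklore] -/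
theorem mem_nfLists_of_foldl : ∀ (l : List (Fin d × Bool)) (k : ℕ),
    (l.foldl nfStep (some k)).isSome = true → l ∈ nfLists d k l.length
  | [], k, _ => by simp [nfLists]
  | a :: l, k, h => by
    rw [List.foldl_cons] at h
    cases hs : nfStep (some k) a with
    | none => rw [hs, foldl_nfStep_none] at h; simp at h
    | some k' =>
      rw [hs] at h
      obtain ⟨ha, hk'⟩ := nfStep_some_eq_some hs
      have ih := mem_nfLists_of_foldl l k' h
      rw [List.length_cons, nfLists, List.mem_flatMap]
      refine ⟨a, ha, List.mem_map.2 ⟨l, ?_, rfl⟩⟩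
      rw [← hk']
      exact ih

/-- `encW` is `encL` of the step list. [folklore] -/
theorem encW_eq_encL : ∀ {n : ℕ} (u : Fin n → Fin d × Bool), encW u = encL d (List.ofFn u)
  | 0, u => by simp [encW, encL]
  | n + 1, u => by
    rw [encW, List.ofFn_succ, encL, encW_eq_encL]
    rfl

/-- **The code of a normal form is enumerated.** [folklore] -/
theorem encW_mem_nfCodes {n : ℕ} {u : Fin n → Fin d × Bool} (h : isNF u = true) : encW u ∈ nfCodes d n := by
  rw [nfCodes, encW_eq_encL, List.mem_map]
  refine ⟨List.ofFn u, ?_, rfl⟩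
  have := mem_nfLists_of_foldl (List.ofFn u) 0 h
  rwa [List.length_ofFn] at this

/-! ### From a row check on the normal-form codes to the full range check -/

/-- B3r: the rows on the enumerated normal forms give the range check of `le_criticalProb_of_checkBK`. [folklore] -/
theorem allRange_nfOKB_of_nfCodes {m pn R S lamN : ℕ} [NeZero d] {tbl : List (ℕ × ℕ)} {dflt N : ℕ}
    (h : (nfCodes d (m + 1)).all (rowOKBK d m pn R S lamN tbl dflt) = true) :
    allRange (nfOKB d m pn R S lamN tbl dflt) 0 N = true := by
  rw [allRange, List.all_eq_true]
  intro c _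
  rw [nfOKB]
  rcases Bool.eq_false_or_eq_true (isNF (decodeW d (m + 1) c)) with hnf | hnf
  · rw [hnf, Bool.not_true, Bool.false_or]
    have h1 := List.all_eq_true.1 h _ (encW_mem_nfCodes hnf)
    rw [rowOKBK, decodeW_encW] at h1
    rw [rowOKBK]
    exact h1
  · rw [hnf, Bool.not_false, Bool.true_or]

/-- B2r: the rows on the enumerated normal forms give the range check of `le_siteCriticalProb_of_checkSK`. [folklore] -/
theorem allRange_nfOKS_of_nfCodes {m pn Q lamN : ℕ} [NeZero d] {tbl : List (ℕ × ℕ)} {dflt N : ℕ}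
    (h : (nfCodes d (m + 1)).all (rowOKSK d m pn Q lamN tbl dflt) = true) :
    allRange (nfOKS d m pn Q lamN tbl dflt) 0 N = true := by
  rw [allRange, List.all_eq_true]
  intro c _
  rw [nfOKS]
  rcases Bool.eq_false_or_eq_true (isNF (decodeW d (m + 1) c)) with hnf | hnf
  · rw [hnf, Bool.not_true, Bool.false_or]
    have h1 := List.all_eq_true.1 h _ (encW_mem_nfCodes hnf)
    rw [rowOKSK, decodeW_encW] at h1
    rw [rowOKSK]
    exact h1
  · rw [hnf, Bool.not_false, Bool.true_or]

/-! ### `List.all` by binary splitting -/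

/-- `List.all` evaluated by binary splitting: `fuel` halvings, leaves of at most `64` elements. [folklore] -/
def allB {α : Type*} (f : α → Bool) : ℕ → List α → Bool
  | 0, l => l.all f
  | fuel + 1, l => if l.length ≤ 64 then l.all f
      else allB f fuel (l.take (l.length / 2)) && allB f fuel (l.drop (l.length / 2))

/-- **Binary splitting computes `List.all`.** [folklore] -/
theorem allB_eq {α : Type*} (f : α → Bool) : ∀ (fuel : ℕ) (l : List α), allB f fuel l = l.all f
  | 0, l => rfl
  | fuel + 1, l => by
    rw [allB]
    split_ifs
    · rfl
    · rw [allB_eq f fuel, allB_eq f fuel, ← List.all_append, List.take_append_drop]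

/-- A binary-split check yields `List.all`. [folklore] -/
theorem all_of_allB {α : Type*} {f : α → Bool} {fuel : ℕ} {l : List α} (h : allB f fuel l = true) : l.all f = true := by
  rw [← allB_eq f fuel]; exact h

/-- Range-restricted sublist of the normal-form codes (for splitting a check over several files). [folklore] -/
def nfCodesIn (d n lo hi : ℕ) : List ℕ := (nfCodes d n).filter fun c => lo ≤ c && c < hi

/-- Combining two adjacent range-restricted checks. [folklore] -/
theorem all_nfCodesIn_append {d n lo mid hi : ℕ} {f : ℕ → Bool} (h1 : (nfCodesIn d n lo mid).all f = true)
    (h2 : (nfCodesIn d n mid hi).all f = true) : (nfCodesIn d n lo hi).all f = true := by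
  rw [nfCodesIn, List.all_eq_true] at h1 h2 ⊢
  intro c hc
  rw [List.mem_filter] at hc
  have hb := hc.2
  simp only [Bool.and_eq_true, decide_eq_true_eq] at hb
  by_cases hm : c < mid
  · exact h1 c (List.mem_filter.2 ⟨hc.1, by simp only [Bool.and_eq_true, decide_eq_true_eq]; omega⟩)
  · exact h2 c (List.mem_filter.2 ⟨hc.1, by simp only [Bool.and_eq_true, decide_eq_true_eq]; omega⟩)

/-- A check on the codes in `[0, hi)` with `hi` above every code is a check on all normal-form codes. [folklore] -/
theorem all_nfCodes_of_nfCodesIn {d n hi : ℕ} {f : ℕ → Bool} (hhi : (nfCodes d n).all (fun c => c < hi) = true)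
    (h : (nfCodesIn d n 0 hi).all f = true) : (nfCodes d n).all f = true := by
  rw [List.all_eq_true] at hhi ⊢
  rw [nfCodesIn, List.all_eq_true] at h
  intro c hc
  have := hhi c hc
  simp only [decide_eq_true_eq] at this
  exact h c (List.mem_filter.2 ⟨hc, by simp only [Bool.and_eq_true, decide_eq_true_eq]; omega⟩)

end WinK

end Summit.CriticalPhenomena.PercolationContinuityZ3.Theorems.Pcint
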